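import Summits.SmoothPoincare4.SmoothPoincare4.Theorems.SullivanDualWitnessChargeReductionV7
import Summits.SmoothPoincare4.SmoothPoincare4.Theorems.SullivanDualWitnessChargeLimitEmbedded
import Summits.SmoothPoincare4.SmoothPoincare4.Theorems.SullivanDualWitnessChargeLocalFamilyUniv

/-!
# Crux `WitnessCharge` (stmt-SmoothPoincare4-7824) modulo two Literature named facts — reduction v8

Line `Sketch` (idea `pencil-incompleteness`), continuation lead c5, cycle 5. The v7 reduction
`WitnessCharge_of_localFamilyUniv_of_limitEmbedded : A' → D1b → WitnessCharge` (lead c4, p129484)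
composed with the two instantiations

* `substub_localFamilyUniv_of_pencilLocalFamily : jPlanePencil_localFamily → A'`
  (`…LocalFamilyUniv.lean`; L2 = Gromov 1985 2.4.A′ / Hofer–Lizan–Sikorav 1997 Thm 1 /
  Wendl LNM 2216 Prop. 2.53, Thm 2.46, Thm 2.11 — the local family of the pencil at a member),
* `substub_limitEmbedded_of_mcduff : jHolomorphicLimitOfEmbedded_isEmbedded → D1b`
  (`…LimitEmbedded.lean`, lead c4; L1b = McDuff 1991 §4 — limits of embedded `J`-planes are embedded),

gives the CONDITIONAL theorem `WitnessCharge_of_facts`: the crux holds under the two named facts of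
the local theory of `J`-holomorphic curves in dimension four. Everything else of Gromov's pencil
argument for an UNTAMED `J` standard at infinity (flat-end confinement, canonical parametrisations,
the Brody–Zalcman dichotomy with the Weierstraß theorem `jHolomorphicWeierstrassR4_holds`, the
continuity method, the covering argument on the simply connected `Σ ∖ p`, the exact taming form of a
complete pencil, subharmonic confinement of the bubble) is proved in the ≈ 80 files
`Theorems/SullivanDualWitnessCharge*.lean` (cycles 1–5). The trust base of `WitnessCharge_of_facts`
is exactly `{jPlanePencil_localFamily, jHolomorphicLimitOfEmbedded_isEmbedded}`.
-/

noncomputable section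

set_option linter.dupNamespace false

open scoped Manifold ContDiff Topology
open Set Filter Literature.Geometry.Kaehler Literature.Geometry.Symplectic
  Literature.Topology.FourManifolds

namespace Summit.SmoothPoincare4.SmoothPoincare4.Theorems.WitnessCharge.PencilIncompleteness

/-- **Crux `WitnessCharge` from the two named facts L2 and L1b** (conditional result; trust base
`jPlanePencil_localFamily` — Gromov/HLS/Wendl local family of the pencil — and
`jHolomorphicLimitOfEmbedded_isEmbedded` — McDuff 1991): for a homotopy 4-sphere `Σ`, `p ∈ Σ`, a
smooth `J` with `J² = −1` on `Σ ∖ p` standard on the punctured `ε'`-chart-ball, and `0 < ε < ε'`, a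
taming witness at radius `ε` forces a non-constant entire `J`-curve avoiding `B_ε`. -/
theorem WitnessCharge_of_facts :
    Literature.Geometry.Symplectic.jPlanePencil_localFamily →
    Literature.Geometry.Symplectic.jHolomorphicLimitOfEmbedded_isEmbedded →
    Summit.SmoothPoincare4.SmoothPoincare4.Theses.SullivanDual.WitnessCharge :=
  fun hL2 hL1b =>
    WitnessCharge_of_localFamilyUniv_of_limitEmbedded
      (substub_localFamilyUniv_of_pencilLocalFamily hL2) (substub_limitEmbedded_of_mcduff hL1b)

/-- **Crux `WitnessCharge` from the CORRECTED L2 and L1b** (conditional result; trust base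
`jPlanePencil_localFamily_homotopySphere` — Gromov/HLS/Wendl local family of the pencil of a
punctured HOMOTOPY 4-SPHERE, the corrected form of `jPlanePencil_localFamily`, which is false for
general compact `M` (erratum in `JPlanePencilLocalFamily.lean`) — and
`jHolomorphicLimitOfEmbedded_isEmbedded` — McDuff 1991, itself proved from the five local facts in
`…LimitEmbeddedLocal.lean`). Supersedes `WitnessCharge_of_facts`. -/
theorem WitnessCharge_of_facts_homotopySphere :
    Literature.Geometry.Symplectic.jPlanePencil_localFamily_homotopySphere →
    Literature.Geometry.Symplectic.jHolomorphicLimitOfEmbedded_isEmbedded →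
    Summit.SmoothPoincare4.SmoothPoincare4.Theses.SullivanDual.WitnessCharge :=
  fun hL2 hL1b =>
    WitnessCharge_of_localFamilyUniv_of_limitEmbedded
      (substub_localFamilyUniv_of_pencilLocalFamily_homotopySphere hL2)
      (substub_limitEmbedded_of_mcduff hL1b)

end Summit.SmoothPoincare4.SmoothPoincare4.Theorems.WitnessCharge.PencilIncompleteness
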